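import Summits.QuantumFields.YangMills.Theorems.BalabanUVNodesN15KingModelBoxFolding
import Summits.QuantumFields.YangMills.Theorems.BalabanUVNodesN15KingModelBlockFieldMassGap
import HarnessLib

/-!
# BalabanUVNodes ∕ N15 — THE KING-MODEL RUNG (PART Ν-g): NE2's UNIT-LATTICE KERNEL ON KING's REGION `Ω` — THE RG BLOCK-FIELD COVARIANCE WITH FREE
# BOUNDARY CONDITIONS `(Δ^{(K)}_Ω)⁻¹ = fold((Δ^{(K)}_{T(2n)})⁻¹)` IS THE IMAGE SUM OF THE TORUS ONE, ITS WOODBURY FORM FOLDS TERMWISE, AND ITS ZERO-MOMENTUM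
# TIMESLICES ARE THE DIRECT TERM, THE PERIODIC IMAGE AND THE TWO NEUMANN IMAGES AT THE BLOCK MASS `N·ω₀`
# (Track A, DAG node N15 = NE2; FAN-OUT v1.1 §N15 s3 «KING-MODEL RUNG» — NE2's analogue decided in the model, now on King's actual region; count-neutral)

HONEST FRAMING.  Count-neutral (cell `pub-ymgap`, seat `pub-ymgap-dag-n15-e` g39; `--supports stmt-QuantumFields-27366 --as helper` = K3⁸).
TEMPLATE LITERATURE: C. King, Commun. Math. Phys. **102** (1986) 649–677 [King1986]: (2.14) p.653 the effective Laplacian `Δ^{(K)}` of the RG block field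
(its inverse is the block-field covariance; NE2's unit-lattice kernel in this lineage, parts Ϛ ∕ Ϲ-d′), §4 p.670 (l.8–13): the Ω-propagators are
multiple-reflection sums ([Ba 4] = [Balaban1983RegularityDecay] (2.42)) — here in the doubled-torus form of part Ν-f: an operator on `Ω` is the torus operator
restricted to reflection-symmetric functions (`foldOp`), a definition OF THESE FILES for the RG block-field operator (King's text concerns `G^η_k`, `G^η_k(Ω)`).  Over part Ν-f (`foldOp`, the homomorphism `foldOp_mul` ∕ `foldOp_inv`, transport) and parts Ϙ-f
(`effLaplacian_torRefl`), Ϛ (`effLaplacian_inv_eq_noise_add_blockAvg`), Ϲ-d′ (`timeSlice_blockCov_eq_cosh'`) THIS FILE reads NE2's UNIT layer on `Ω`: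
(§1) a box timeslice of ANY folded reflection-symmetric kernel is two torus timeslices (`timeSlice_foldOp_eq_two_torusSlices`); (§2) `Δ^{(K)}` on the unit
torus `Π_μ ℤ∕2n_μ` is reflection symmetric and invertible, so for King's `Δ^{(K)}_Ω := fold(Δ^{(K)})`: ★★★ **`foldOp_effLaplacian_inv`** —
`(Δ^{(K)}_Ω)⁻¹ = fold((Δ^{(K)})⁻¹)`, i.e. `(Δ^{(K)}_Ω)⁻¹(b,b′) = Σ_S (Δ^{(K)}_{T(2n)})⁻¹(dblBox b, σ_S dblBox b′)` (`a > 0`, `c ≥ 0`, `m² > 0`), and in King's units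
`c = N²` the Woodbury form folds termwise: ★★ `foldOp_effLaplacian_inv_eq_noise_add` (`= a⁻¹·1 + N^{d+1}·fold(Q B⁻¹ Qᵀ)`: block-spin white noise with the exact
two-spacing rate plus the image sum of the torus block two-point function); (§3) ★★★ **`timeSlice_fold_blockCov`** — for every slice `α ≠ t_κ`,
`Σ_{b′_κ = α}(Δ^{(K)}_Ω)⁻¹(b′,t) = N^{−3}P∕D · (e^{−Nω₀|α−t_κ|} + e^{−Nω₀(2n_κ−|α−t_κ|)} + e^{−Nω₀(2n_κ−1−α−t_κ)} + e^{−Nω₀(α+t_κ+1)})`, `ω₀ = latticeMass(m²∕N²)`,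
`P = (sinh(Nω₀∕2)∕sinh(ω₀∕2))²`, `D = 2 sinh ω₀(1 − e^{−ω₀N·2n_κ})`: the direct term, its periodic image (period `2n_κ` of the DOUBLED torus) and the two
Neumann images, all at the BLOCK MASS `N·ω₀` of part Ϲ-d′ — the block-spin RG with free boundary conditions has the torus gap; only the images change.
NOT Bałaban's covariant objects; NOT a node discharge (N15 is booked through n15-a's knit, untouched); `Δ^{(K)}_Ω` is a DEFINITION-by-folding of these files (its
identification with a block-spin construction performed directly on `Ω`, or with any object of [King1986], is not asserted); nothing continuum-YM ∕ `ℝ⁴` ∕ OS axioms ∕ Clay.  0 `sorry`, 0 `def`.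

WHAT THIS FILE PROVES (kernel).  §1 ★ `timeSlice_foldOp_eq_two_torusSlices`.  §2 `isReflSymm_effLaplacian`, `isReflSymm_effLaplacian_inv`, `isUnit_effLaplacian`,
★★★ **`foldOp_effLaplacian_inv`**, `foldOp_effLaplacian_inv_apply`, ★★ `foldOp_effLaplacian_inv_eq_noise_add`.  §3 `timeSlice_effLaplacian_inv_source`, `exp_val_sub_pair`,
`val_mirror_pair`, `mirror_sub_ne_zero`, ★★★ **`timeSlice_fold_blockCov`**.

HONEST SCOPE.  Unit box `Ω = Π_μ Fin n_μ` (any sides `n_μ ≥ 1`), `N ≥ 1` fine sites per block side, `a > 0`, `m² > 0` (`c ≥ 0` in §2; `c = N²` in the Woodbury and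
timeslice statements); the contact slice `α = t_κ` (white-noise term) is not displayed.  King's `A = 0` scalar model; N15 untouched; counts unmoved.  Locators:
[King1986] (2.14) p.653, (2.17) p.653, (4.5) p.670 (symbol), §4 p.670 (l.8–13, multiple reflections after [Ba 4] (2.42)); [Balaban1983RegularityDecay] (2.42) p.584;
[MontvayMunster1994] §2.1.2 (2.49), §2.2.1 (2.74)–(2.82).
-/

noncomputable section

open scoped BigOperators symmDiff
open Finset Matrix

namespace Summit.QuantumFields.YangMills.BalabanUVNodes.N15KingModelRung.TorusSpectral

open Literature.MathematicalPhysics.QuantumFieldTheory.Balaban1983to89.B5Prop11Plancherel (Tor fine unitVec)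
open Literature.MathematicalPhysics.QuantumFieldTheory.Balaban1983to89.QGQInverse (Coercive isUnit_of_coercive)
open Literature.MathematicalPhysics.QuantumFieldTheory.King1986.Torus
open Summit.QuantumFields.YangMills.BalabanUVNodes.N15.TwoGrid (torRefl torRefl_torRefl torRefl_apply_same torRefl_apply_ne)
open Summit.QuantumFields.YangMills.BalabanUVNodes.N15KingModelRung.Curved (effLaplacian_torRefl effLaplacian_inv_torRefl)

variable {d : ℕ}

/-! ## §1 Timeslices of a folded kernel are two torus slices -/

section FoldSlices

variable (n : Fin (d + 1) → ℕ) [hn : ∀ μ, NeZero (n μ)] (κ : Fin (d + 1))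

/-- ★ **A BOX TIMESLICE OF A FOLDED KERNEL IS TWO TORUS TIMESLICES**: for reflection-symmetric `A`,
`Σ_{s′ ∈ Ω : s′_κ = a} fold(A)(s′,t) = Σ_{w : w_κ = a} A(w, dblBox t) + Σ_{w : w_κ = −1−a} A(w, dblBox t)` (the transverse folded sum is the full transverse
torus sum; part Ν-b for `A = B⁻¹`). [cite: King1986, §4 p.670] -/
theorem timeSlice_foldOp_eq_two_torusSlices {A : Matrix (Tor (dblPer n)) (Tor (dblPer n)) ℝ} (hA : IsReflSymm n A) (t : KingBox n) (a : Fin (n κ)) :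
    ∑ s' : KingBox n, (if s' κ = a then foldOp n A s' t else 0)
      = (∑ w : Tor (dblPer n), (if w κ = ((a.val : ℕ) : ZMod (2 * n κ)) then A w (dblBox n t) else 0))
        + ∑ w : Tor (dblPer n), (if w κ = -1 - ((a.val : ℕ) : ZMod (2 * n κ)) then A w (dblBox n t) else 0) := by
  rw [← sum_foldSlice_eq, sum_dblTorus_eq_sum_images]
  simp_rw [foldBox_torReflS_dblBox]
  rw [Finset.sum_comm]
  refine Finset.sum_congr rfl fun s' _ => ?_
  by_cases h : s' κ = a
  · simp only [h, if_true, foldOp]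
    refine Finset.sum_congr rfl fun S _ => ?_
    rw [← hA S (dblBox n s') (torReflS (dblPer n) S (dblBox n t)), torReflS_torReflS]
  · simp only [h, if_false, Finset.sum_const_zero]

end FoldSlices

/-! ## §2 King's effective Laplacian `Δ^{(K)}` and RG block-field covariance `(Δ^{(K)})⁻¹` on the box with free boundary conditions -/

section BlockField

variable (N : ℕ) [NeZero N] (n : Fin (d + 1) → ℕ) [hn : ∀ μ, NeZero (n μ)]

/-- King's effective Laplacian `Δ^{(K)}` on the unit torus `Π_μ ℤ∕2n_μ` is reflection symmetric (part Ϙ-f `effLaplacian_torRefl`). [cite: King1986, (2.14) p.653, (4.5) p.670] -/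
theorem isReflSymm_effLaplacian (a c m2 : ℝ) : IsReflSymm n (effLaplacian N (dblPer n) a c m2) :=
  isReflSymm_of_torRefl n fun κ x y => effLaplacian_torRefl N (dblPer n) κ a c m2 x y

/-- `(Δ^{(K)})⁻¹` is reflection symmetric. [cite: King1986, (2.14) p.653] -/
theorem isReflSymm_effLaplacian_inv (a c m2 : ℝ) : IsReflSymm n (effLaplacian N (dblPer n) a c m2)⁻¹ :=
  (isReflSymm_effLaplacian N n a c m2).inv

/-- `Δ^{(K)}` is invertible (`a > 0`, `c ≥ 0`, `m² > 0`). [cite: King1986, (2.14) p.653] -/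
theorem isUnit_effLaplacian {a c m2 : ℝ} (ha : 0 < a) (hc : 0 ≤ c) (hm : 0 < m2) : IsUnit (effLaplacian N (dblPer n) a c m2) :=
  isUnit_of_coercive (by positivity) (effLaplacian_coercive_of_nonneg N (dblPer n) ha hc hm)

/-- ★★★ **NE2's UNIT-LATTICE KERNEL ON KING's REGION `Ω`: THE RG BLOCK-FIELD COVARIANCE WITH FREE BOUNDARY CONDITIONS IS THE IMAGE SUM OF THE TORUS ONE.**
With the operators on `Ω` defined by folding (part Ν-f; the doubled-torus form of the method King invokes on p.670), for the effective Laplacian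
`Δ^{(K)}_Ω := fold(Δ^{(K)}_{T(2n)})` the homomorphism of part Ν-f gives
`(Δ^{(K)}_Ω)⁻¹ = fold((Δ^{(K)}_{T(2n)})⁻¹)`, i.e. `(Δ^{(K)}_Ω)⁻¹(b,b′) = Σ_{S⊆{0,…,d}} (Δ^{(K)}_{T(2n)})⁻¹(dblBox b, σ_S dblBox b′)` (`a > 0`, `c ≥ 0`, `m² > 0`).
[cite: King1986, (2.14) p.653, (4.5) p.670, §4 p.670] -/
theorem foldOp_effLaplacian_inv {a c m2 : ℝ} (ha : 0 < a) (hc : 0 ≤ c) (hm : 0 < m2) :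
    (foldOp n (effLaplacian N (dblPer n) a c m2))⁻¹ = foldOp n (effLaplacian N (dblPer n) a c m2)⁻¹ :=
  foldOp_inv n (isReflSymm_effLaplacian N n a c m2) (isUnit_effLaplacian N n ha hc hm)

/-- Entrywise form. [cite: King1986, (2.14) p.653, §4 p.670] -/
theorem foldOp_effLaplacian_inv_apply {a c m2 : ℝ} (ha : 0 < a) (hc : 0 ≤ c) (hm : 0 < m2) (b b' : KingBox n) :
    (foldOp n (effLaplacian N (dblPer n) a c m2))⁻¹ b b'
      = ∑ S : Finset (Fin (d + 1)), (effLaplacian N (dblPer n) a c m2)⁻¹ (dblBox n b) (torReflS (dblPer n) S (dblBox n b')) := by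
  rw [foldOp_effLaplacian_inv N n ha hc hm]; rfl

/-- ★★ **THE WOODBURY FORM FOLDS TERMWISE**: in King's units `c = N²`, `(Δ^{(K)}_Ω)⁻¹ = a⁻¹·1 + N^d·fold(Q B⁻¹ Qᵀ)` — block-spin white noise with the exact
two-spacing rate PLUS the image sum of the torus block two-point function (part Ϛ `effLaplacian_inv_eq_noise_add_blockAvg`).
[cite: King1986, (2.14) p.653, (2.17) p.653, §4 p.670] -/
theorem foldOp_effLaplacian_inv_eq_noise_add (hN1 : 1 ≤ N) {a m2 : ℝ} (ha : 0 < a) (hm : 0 < m2) :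
    (foldOp n (effLaplacian N (dblPer n) a ((N : ℝ) ^ 2) m2))⁻¹
      = a⁻¹ • (1 : Matrix (KingBox n) (KingBox n) ℝ)
        + ((N : ℝ) ^ (d + 1)) • foldOp n (Qmat N (dblPer n) * (lapF (fine N (dblPer n)) ((N : ℝ) ^ 2) m2)⁻¹ * (Qmat N (dblPer n))ᵀ) := by
  rw [foldOp_effLaplacian_inv N n ha (by positivity) hm, effLaplacian_inv_eq_noise_add_blockAvg N (dblPer n) hN1 ha hm,
    foldOp_add, foldOp_smul, foldOp_smul, foldOp_one]

end BlockField


/-! ## §3 The RG block field on `Ω` with free boundary conditions: zero-momentum timeslices at the block mass `N·ω₀` -/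

section BlockFieldSlices

variable (N : ℕ) [NeZero N] (n : Fin (d + 1) → ℕ) [hn : ∀ μ, NeZero (n μ)] (κ : Fin (d + 1))

/-- A general source for the torus block covariance: `Σ_{b : b_κ = s} (Δ^{(K)})⁻¹(b, y) = Σ_{w : w_κ = s − y_κ} (Δ^{(K)})⁻¹(w, 0)` (translation invariance,
part Ϙ-a `effLaplacian_inv_transl`). [cite: King1986, (2.14) p.653] -/
theorem timeSlice_effLaplacian_inv_source (M : Fin (d + 1) → ℕ) [∀ μ, NeZero (M μ)] (a c m2 : ℝ) (y : Tor M) (s : ZMod (M κ)) :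
    ∑ b : Tor M, (if b κ = s then (effLaplacian N M a c m2)⁻¹ b y else 0)
      = ∑ w : Tor M, (if w κ = s - y κ then (effLaplacian N M a c m2)⁻¹ w 0 else 0) := by
  set G : Tor M → ℝ := fun w => (effLaplacian N M a c m2)⁻¹ w 0 with hG
  have h : ∀ b : Tor M, (effLaplacian N M a c m2)⁻¹ b y = G (b + -y) := by
    intro b
    show (effLaplacian N M a c m2)⁻¹ b y = (effLaplacian N M a c m2)⁻¹ (b + -y) 0
    rw [← Transl.effLaplacian_inv_transl N M a c m2 (b + -y) 0 y, neg_add_cancel_right, zero_add]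
  have h2 : ∑ b : Tor M, (if b κ = s then (effLaplacian N M a c m2)⁻¹ b y else 0) = ∑ b : Tor M, (if b κ = s then G (b + -y) else 0) :=
    Finset.sum_congr rfl fun b _ => by rw [h]
  rw [h2, sum_slice_comp_add M κ G (-y) s, Pi.neg_apply, ← sub_eq_add_neg]

omit hn in
/-- `val` bookkeeping on `ℤ∕2n_κ` for box coordinates `a, t < n_κ`: the direct pair `{val(a − t), 2n_κ − val(a − t)} = {|a − t|, 2n_κ − |a − t|}` read on
the exponentials. [folklore] -/
theorem exp_val_sub_pair (x : ℝ) (a t : Fin (n κ)) :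
    Real.exp (-(x * ((((a.val : ℕ) : ZMod (2 * n κ)) - ((t.val : ℕ) : ZMod (2 * n κ))).val : ℕ)))
        + Real.exp (-(x * ((2 * n κ : ℕ) - (((((a.val : ℕ) : ZMod (2 * n κ)) - ((t.val : ℕ) : ZMod (2 * n κ))).val : ℕ) : ℝ))))
      = Real.exp (-(x * |((a.val : ℝ) - t.val)|)) + Real.exp (-(x * ((2 * n κ : ℕ) - |((a.val : ℝ) - t.val)|))) := by
  have ha := a.isLt
  have ht := t.isLt
  rcases le_or_gt t.val a.val with hta | hat
  · -- no wrap: `val(a − t) = a − t = |a − t|`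
    have hv : ((((a.val : ℕ) : ZMod (2 * n κ)) - ((t.val : ℕ) : ZMod (2 * n κ))).val : ℕ) = a.val - t.val := by
      rw [← Nat.cast_sub hta, ZMod.val_cast_of_lt (by omega)]
    have habs : |((a.val : ℝ) - t.val)| = ((a.val - t.val : ℕ) : ℝ) := by
      rw [Nat.cast_sub hta, abs_of_nonneg (by rw [sub_nonneg]; exact_mod_cast hta)]
    rw [hv, habs]
  · -- wrap: `val(a − t) = 2n − (t − a)`, and the two exponentials swap
    have hv : ((((a.val : ℕ) : ZMod (2 * n κ)) - ((t.val : ℕ) : ZMod (2 * n κ))).val : ℕ) = 2 * n κ - (t.val - a.val) := by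
      have hc : (((a.val : ℕ) : ZMod (2 * n κ)) - ((t.val : ℕ) : ZMod (2 * n κ))) = ((2 * n κ - (t.val - a.val) : ℕ) : ZMod (2 * n κ)) := by
        have e : (((2 * n κ - (t.val - a.val) : ℕ) : ZMod (2 * n κ))) + ((t.val : ℕ) : ZMod (2 * n κ))
            = ((2 * n κ : ℕ) : ZMod (2 * n κ)) + ((a.val : ℕ) : ZMod (2 * n κ)) := by
          norm_cast; congr 1; omega
        rw [ZMod.natCast_self, zero_add] at e
        linear_combination -e
      rw [hc, ZMod.val_cast_of_lt (by omega)]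
    have habs : |((a.val : ℝ) - t.val)| = ((t.val - a.val : ℕ) : ℝ) := by
      rw [Nat.cast_sub hat.le, abs_of_neg (by rw [sub_neg]; exact_mod_cast hat)]; ring
    rw [hv, habs, add_comm]
    congr 2
    · push_cast [Nat.cast_sub (show t.val - a.val ≤ 2 * n κ by omega), Nat.cast_sub hat.le]; ring
    · push_cast [Nat.cast_sub (show t.val - a.val ≤ 2 * n κ by omega), Nat.cast_sub hat.le]; ring

/-- `val` bookkeeping for the mirror pair: `val(−1 − a − t) = 2n_κ − 1 − a − t` and `2n_κ − val = a + t + 1`. [folklore] -/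
theorem val_mirror_pair (a t : Fin (n κ)) :
    ((-1 - ((a.val : ℕ) : ZMod (2 * n κ)) - ((t.val : ℕ) : ZMod (2 * n κ))).val : ℕ) = 2 * n κ - 1 - (a.val + t.val) := by
  have ha := a.isLt
  have ht := t.isLt
  have h : (-1 - ((a.val : ℕ) : ZMod (2 * n κ)) - ((t.val : ℕ) : ZMod (2 * n κ))) = -1 - (((a.val + t.val : ℕ)) : ZMod (2 * n κ)) := by
    push_cast; ring
  rw [h, val_neg_one_sub_natCast (n κ) (by omega)]

/-- The mirror slice is never the source slice: `−1 − a − t ≠ 0` in `ℤ∕2n_κ`. [folklore] -/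
theorem mirror_sub_ne_zero (a t : Fin (n κ)) : (-1 - ((a.val : ℕ) : ZMod (2 * n κ)) - ((t.val : ℕ) : ZMod (2 * n κ))) ≠ 0 := by
  intro h
  have hv := congrArg ZMod.val h
  rw [val_mirror_pair n κ a t, ZMod.val_zero] at hv
  have ha := a.isLt
  have ht := t.isLt
  omega

/-- ★★★ **THE RG BLOCK FIELD ON KING's REGION `Ω` WITH FREE BOUNDARY CONDITIONS: ITS ZERO-MOMENTUM TIMESLICE CORRELATOR IS THE DIRECT TERM, ITS PERIODIC
IMAGE AND THE TWO NEUMANN IMAGES, ALL AT THE BLOCK MASS `N·ω₀`.**  In King's units (`c = N²`, `N ≥ 1` fine sites per block side, `a > 0`, `m² > 0`), for the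
unit box `Ω = Π_μ{0,…,n_μ−1}`, every axis `κ`, every source block `t` and every slice `a ≠ t_κ`:
`Σ_{b′ ∈ Ω : b′_κ = a} (Δ^{(K)}_Ω)⁻¹(b′,t) = N^{−3}·P∕(2 sinh ω₀(1 − e^{−ω₀N·2n_κ})) · (e^{−Nω₀|a−t_κ|} + e^{−Nω₀(2n_κ−|a−t_κ|)} + e^{−Nω₀(2n_κ−1−a−t_κ)} + e^{−Nω₀(a+t_κ+1)})`,
`ω₀ = latticeMass(m²∕N²)`, `P = (sinh(Nω₀∕2)∕sinh(ω₀∕2))²` — part Ϲ-d′'s pure block-time cosh of the torus `Π ℤ∕2n_μ` at the two separations `a − t_κ`,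
`−1−a−t_κ`: the block-spin RG with free boundary conditions has the SAME gap `N·ω₀` per block step; only the images change.
[cite: King1986, (2.14) p.653, (4.5) p.670, §4 p.670; MontvayMunster1994, §2.1.2 (2.49), §2.2.1 (2.74)–(2.82)] -/
theorem timeSlice_fold_blockCov (hN1 : 1 ≤ N) {a m2 : ℝ} (ha : 0 < a) (hm : 0 < m2) (t : KingBox n) {α : Fin (n κ)} (hα : α ≠ t κ) :
    ∑ b' : KingBox n, (if b' κ = α then (foldOp n (effLaplacian N (dblPer n) a ((N : ℝ) ^ 2) m2))⁻¹ b' t else 0)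
      = ((N : ℝ) ^ 3)⁻¹
          * ((Real.sinh (N * latticeMass (m2 / (N : ℝ) ^ 2) / 2) / Real.sinh (latticeMass (m2 / (N : ℝ) ^ 2) / 2)) ^ 2
            / (2 * Real.sinh (latticeMass (m2 / (N : ℝ) ^ 2)) * (1 - Real.exp (-(latticeMass (m2 / (N : ℝ) ^ 2) * N * (2 * n κ : ℕ))))))
          * ((Real.exp (-(latticeMass (m2 / (N : ℝ) ^ 2) * N * |((α.val : ℝ) - (t κ).val)|))
              + Real.exp (-(latticeMass (m2 / (N : ℝ) ^ 2) * N * ((2 * n κ : ℕ) - |((α.val : ℝ) - (t κ).val)|))))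
            + (Real.exp (-(latticeMass (m2 / (N : ℝ) ^ 2) * N * ((2 * n κ - 1 - (α.val + (t κ).val) : ℕ) : ℝ)))
              + Real.exp (-(latticeMass (m2 / (N : ℝ) ^ 2) * N * ((α.val : ℝ) + (t κ).val + 1))))) := by
  rw [foldOp_effLaplacian_inv N n ha (by positivity) hm,
    timeSlice_foldOp_eq_two_torusSlices n κ (isReflSymm_effLaplacian_inv N n a _ m2) t α,
    timeSlice_effLaplacian_inv_source N κ (dblPer n) a _ m2 (dblBox n t) (((α.val : ℕ) : ZMod (2 * n κ))),
    timeSlice_effLaplacian_inv_source N κ (dblPer n) a _ m2 (dblBox n t) (-1 - ((α.val : ℕ) : ZMod (2 * n κ)))]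
  -- the two torus slices: separations `s₁ = α − t_κ ≠ 0` and `s₂ = −1 − α − t_κ ≠ 0`
  have hs1 : ((((α.val : ℕ) : ZMod (2 * n κ)) - dblBox n t κ : ZMod (dblPer n κ))) ≠ 0 := by
    intro h
    apply hα
    have h' : (((α.val : ℕ) : ZMod (2 * n κ))) = dblBox n t κ := sub_eq_zero.mp h
    have hv := congrArg ZMod.val h'
    rw [ZMod.val_cast_of_lt (show α.val < 2 * n κ by have := α.isLt; omega), val_dblBox] at hv
    exact Fin.ext hv
  have hs2 : ((-1 - ((α.val : ℕ) : ZMod (2 * n κ)) - dblBox n t κ : ZMod (dblPer n κ))) ≠ 0 := mirror_sub_ne_zero n κ α (t κ)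
  rw [timeSlice_blockCov_eq_cosh' N (dblPer n) κ hN1 ha hm hs1, timeSlice_blockCov_eq_cosh' N (dblPer n) κ hN1 ha hm hs2, ← mul_add]
  congr 1
  have e1 := exp_val_sub_pair n κ (latticeMass (m2 / (N : ℝ) ^ 2) * N) α (t κ)
  have e2 := val_mirror_pair n κ α (t κ)
  have hper : ((dblPer n κ : ℕ) : ℝ) = ((2 * n κ : ℕ) : ℝ) := rfl
  simp only [dblBox] at e1 e2 ⊢
  rw [hper, e2]
  have hαt : α.val + (t κ).val < 2 * n κ := by have := α.isLt; have := (t κ).isLt; omega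
  have hsum : ((2 * n κ : ℕ) : ℝ) - ((2 * n κ - 1 - (α.val + (t κ).val) : ℕ) : ℝ) = (α.val : ℝ) + (t κ).val + 1 := by
    rw [Nat.cast_sub (by omega), Nat.cast_sub (by omega)]; push_cast; ring
  rw [hsum, e1]

end BlockFieldSlices

end Summit.QuantumFields.YangMills.BalabanUVNodes.N15KingModelRung.TorusSpectral
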